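import Mathlib
import Literature.MathematicalPhysics.QuantumFieldTheory.ConstructiveQFTWave0OddRPProofs
import Literature.MathematicalPhysics.QuantumFieldTheory.LatticeGaugeProofs
import Literature.MathematicalPhysics.QuantumFieldTheory.LatticeGaugeStaticPotentialProofs
import HarnessLib

/-!
# Stub `stub_oddTorusRP` of the line `sup-axis-reflection-transfer` (crux `stmt-QuantumFields-9442`)

Route `FradkinShenkerFlow` of `YangMills`, crux item `stmt-QuantumFields-9442`
(`Summit.QuantumFields.YangMills.Theses.FradkinShenkerFlow.FiniteSusceptibilityWeakCoupling`), line
`sup-axis-reflection-transfer`, stub `stub_oddTorusRP` (STUB 1 of the lead's registered skeleton).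

**What is proved.** Odd-torus reflection positivity of Wilson's lattice gauge measure in EVERY axis
direction `π` and EVERY link hyperplane `v` (real, uncentred form): for `L = 2S+1 ≥ 3`, `β ≥ 0`, a continuous
representation `ρ` of a compact group `G`, a permutation `π` of the four axes and a torus translation `v`,
let `Φ = τ_v ∘ π_*` (`Φ U = torusConfigShift v (configPerm π U)`, so `(Φ U) e = U (ψ e)` with
`ψ e = (sitePerm π⁻¹ (e.1 - v), π⁻¹ e.2)`) and `Θ = Φ ∘ Θ₀ ∘ Φ⁻¹` the transported time reflection
(`Θ₀ = GaugeConfig.timeReflect`, `θ t = 1 - t`). For every bounded measurable real `F` depending only on the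
links `e` with `ψ e` in the tree's positive half `{IsOPosEdge} ∪ {IsOSharedEdge}`,

  `0 ≤ ∫ F (Θ U) · F U dμ_{β,2S+1}(U)`.

**Proof.** Transport of the tree theorem `wilsonExpectation_oddReflectionPositive` (Osterwalder–Seiler
reflection positivity on the odd torus for the axis-`0` reflection `Θ₀`): the observable `F ∘ Φ` depends only
on `oPosEdges ∪ oSharedEdges`, so `0 ≤ ∫ F(Φ(Θ₀ W)) F(Φ W) dμ(W)`
(`OddTorusRP.integral_timeReflect_mul_nonneg`, the real reading of the complex tree statement); then
change variables `U = Φ W`, using that `Φ` is a measurable equivalence preserving `μ = wilsonMeasure ρ β`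
(`wilsonMeasure_map_configPerm`, `wilsonMeasure_map_torusConfigShift`) and `Φ⁻¹ (Φ W) = W`
(`OddTorusRP.configPerm_symm_configPerm`, `OddTorusRP.torusConfigShift_neg_torusConfigShift`).
-/

noncomputable section

open MeasureTheory
open Literature.MathematicalPhysics.QuantumFieldTheory

namespace Summit.QuantumFields.YangMills.Theorems.FiniteSusceptibilityWeakCoupling

namespace OddTorusRP

variable {G : Type} [Group G] [TopologicalSpace G] [IsTopologicalGroup G] [CompactSpace G]
  [MeasurableSpace G] [BorelSpace G] {N : ℕ} (ρ : G →* Matrix (Fin N) (Fin N) ℂ)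

-- adapted from the sibling skeleton `Cruxes/FiniteSusceptibilityWeakCoupling/Lines/mirror-moment-transfer.lean`
-- (`MirrorMomentTransfer.rp_uncentred_real`)
/-- **Uncentred RP for real positive-half observables** on the odd torus of side `2S+1`, `S ≥ 1`: the real
reading of the tree's complex statement `wilsonExpectation_oddReflectionPositive` (axis-`0` reflection
`Θ₀ = GaugeConfig.timeReflect`, `θ t = 1 - t`): `0 ≤ ∫ F(Θ₀ U) F(U) dμ_{β}` for bounded measurable real `F`
depending only on `oPosEdges ∪ oSharedEdges`. [folklore] -/
theorem integral_timeReflect_mul_nonneg (hρ : Continuous ρ) {β : ℝ} (hβ : 0 ≤ β) {d S : ℕ} [NeZero d]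
    (hS : 1 ≤ S) (F : GaugeConfig d (2 * S + 1) G → ℝ) (hF : Measurable F) (hFb : ∃ C : ℝ, ∀ U, |F U| ≤ C)
    (hFdep : DependsOn F ((WilsonOddRP.oPosEdges ∪ WilsonOddRP.oSharedEdges :
        Finset (Edge d (2 * S + 1))) : Set (Edge d (2 * S + 1)))) :
    0 ≤ ∫ U, F (GaugeConfig.timeReflect U) * F U ∂(wilsonMeasure (d := d) (L := 2 * S + 1) ρ β) := by
  obtain ⟨C, hC⟩ := hFb
  have h := wilsonExpectation_oddReflectionPositive (d := d) (L := 2 * S + 1) ρ ⟨S, by ring⟩ (by omega)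
    hρ hβ (fun U => ((F U : ℝ) : ℂ)) (Complex.measurable_ofReal.comp hF)
    ⟨C, fun U => by simpa [Complex.norm_real, Real.norm_eq_abs] using hC U⟩
    (fun U V hUV => by simp only [hFdep hUV])
  have hre : (wilsonExpectation ρ β fun U : GaugeConfig d (2 * S + 1) G =>
      (starRingEnd ℂ) ((F U.timeReflect : ℝ) : ℂ) * ((F U : ℝ) : ℂ)) =
      ((∫ U, F (GaugeConfig.timeReflect U) * F U
          ∂(wilsonMeasure (d := d) (L := 2 * S + 1) ρ β) : ℝ) : ℂ) := by
    simp only [wilsonExpectation, Complex.conj_ofReal, ← Complex.ofReal_mul]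
    exact integral_ofReal
  rw [hre] at h
  exact Complex.zero_le_real.1 h

omit [Group G] [TopologicalSpace G] [IsTopologicalGroup G] [CompactSpace G] [BorelSpace G] in
/-- `sitePerm π⁻¹ ∘ sitePerm π = id` on torus sites. [folklore] -/
theorem sitePerm_symm_sitePerm {d L : ℕ} (π : Equiv.Perm (Fin d)) (x : Site d L) :
    sitePerm π.symm (sitePerm π x) = x := by
  funext j
  simp only [sitePerm_apply, Equiv.symm_symm, Equiv.symm_apply_apply]

omit [Group G] [TopologicalSpace G] [IsTopologicalGroup G] [CompactSpace G] [BorelSpace G] in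
/-- `configPerm π⁻¹ ∘ configPerm π = id` on torus gauge configurations. [folklore] -/
theorem configPerm_symm_configPerm {d L : ℕ} (π : Equiv.Perm (Fin d)) (U : GaugeConfig d L G) :
    configPerm π.symm (configPerm π U) = U := by
  funext e
  simp only [configPerm_apply, Equiv.symm_symm, Equiv.symm_apply_apply, sitePerm_symm_sitePerm]

omit [Group G] [TopologicalSpace G] [IsTopologicalGroup G] [CompactSpace G] [BorelSpace G] in
/-- `torusConfigShift (-v) ∘ torusConfigShift v = id` on torus gauge configurations. [folklore] -/
theorem torusConfigShift_neg_torusConfigShift {d L : ℕ} (v : Site d L) (U : GaugeConfig d L G) :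
    torusConfigShift (-v) (torusConfigShift v U) = U := by
  funext e
  simp only [torusConfigShift_apply, sub_neg_eq_add, add_sub_cancel_right]

/-- The composite symmetry `Φ = τ_v ∘ π_*` preserves the torus Wilson measure. [folklore] -/
theorem wilsonMeasure_map_configPerm_trans_torusConfigShift {d L : ℕ} [NeZero L] (hρ : Continuous ρ)
    (β : ℝ) (π : Equiv.Perm (Fin d)) (v : Site d L) :
    (wilsonMeasure ρ β).map ((configPerm π).trans (torusConfigShift v)) =
      wilsonMeasure (d := d) (L := L) (G := G) ρ β := by
  rw [MeasurableEquiv.coe_trans,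
    ← Measure.map_map (torusConfigShift v).measurable (configPerm π).measurable,
    wilsonMeasure_map_configPerm ρ hρ, wilsonMeasure_map_torusConfigShift]

end OddTorusRP

/-- **STUB 1 · `stub_oddTorusRP`** of the line `sup-axis-reflection-transfer` for crux `stmt-QuantumFields-9442`:
odd-torus reflection positivity of Wilson's lattice gauge measure in every axis direction `π` and every link
hyperplane `v` (real, uncentred form) — for `L = 2S+1 ≥ 3`, `β ≥ 0`, continuous `ρ` and a bounded measurable
real `F` depending only on the transported positive half, `0 ≤ ∫ F(Φ(Θ₀(Φ⁻¹ U))) F(U) dμ_{β,2S+1}` with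
`Φ = torusConfigShift v ∘ configPerm π`. Transport of the tree theorem `wilsonExpectation_oddReflectionPositive`
through the measure-preserving equivalences `configPerm π` and `torusConfigShift v`. [folklore] -/
theorem stub_oddTorusRP : ∀ (G : Type) [Group G] [TopologicalSpace G] [IsTopologicalGroup G] [CompactSpace G] [MeasurableSpace G] [BorelSpace G] (N : ℕ) (ρ : G →* Matrix (Fin N) (Fin N) ℂ), Continuous ρ → ∀ (β : ℝ), 0 ≤ β → ∀ (S : ℕ), 1 ≤ S → ∀ (π : Equiv.Perm (Fin 4)) (v : Literature.MathematicalPhysics.QuantumFieldTheory.Site 4 (2 * S + 1)) (F : Literature.MathematicalPhysics.QuantumFieldTheory.GaugeConfig 4 (2 * S + 1) G → ℝ), Measurable F → (∃ C : ℝ, ∀ U, |F U| ≤ C) → DependsOn F {e : Literature.MathematicalPhysics.QuantumFieldTheory.Edge 4 (2 * S + 1) | Literature.MathematicalPhysics.QuantumFieldTheory.WilsonOddRP.IsOPosEdge (Literature.MathematicalPhysics.QuantumFieldTheory.sitePerm π.symm (e.1 - v), π.symm e.2) ∨ Literature.MathematicalPhysics.QuantumFieldTheory.WilsonOddRP.IsOSharedEdge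 (Literature.MathematicalPhysics.QuantumFieldTheory.sitePerm π.symm (e.1 - v), π.symm e.2)} → 0 ≤ ∫ U, F (Literature.MathematicalPhysics.QuantumFieldTheory.torusConfigShift v (Literature.MathematicalPhysics.QuantumFieldTheory.configPerm π (Literature.MathematicalPhysics.QuantumFieldTheory.GaugeConfig.timeReflect (Literature.MathematicalPhysics.QuantumFieldTheory.configPerm π.symm (Literature.MathematicalPhysics.QuantumFieldTheory.torusConfigShift (-v) U))))) * F U ∂(Literature.MathematicalPhysics.QuantumFieldTheory.wilsonMeasure (d := 4) (L := 2 * S + 1) ρ β) := by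
  intro G _ _ _ _ _ _ N ρ hρ β hβ S hS π v F hF hFb hFdep
  obtain ⟨C, hC⟩ := hFb
  -- the transported observable `F ∘ Φ` lives on the tree's positive half
  have hdep : DependsOn
      (fun W : Literature.MathematicalPhysics.QuantumFieldTheory.GaugeConfig 4 (2 * S + 1) G =>
        F (torusConfigShift v (configPerm π W)))
      ((WilsonOddRP.oPosEdges ∪ WilsonOddRP.oSharedEdges :
        Finset (Literature.MathematicalPhysics.QuantumFieldTheory.Edge 4 (2 * S + 1))) :
        Set (Literature.MathematicalPhysics.QuantumFieldTheory.Edge 4 (2 * S + 1))) := by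
    intro W W' hWW'
    refine hFdep fun e he => ?_
    simp only [torusConfigShift_apply, configPerm_apply]
    refine hWW' _ ?_
    simpa only [Finset.coe_union, Set.mem_union, Finset.mem_coe, WilsonOddRP.mem_oPosEdges,
      WilsonOddRP.mem_oSharedEdges, Set.mem_setOf_eq] using he
  -- reflection positivity for `F ∘ Φ` and the axis-`0` reflection
  have h0 : 0 ≤ ∫ W, F (torusConfigShift v (configPerm π (GaugeConfig.timeReflect W))) *
      F (torusConfigShift v (configPerm π W)) ∂(wilsonMeasure (d := 4) (L := 2 * S + 1) ρ β) :=
    OddTorusRP.integral_timeReflect_mul_nonneg ρ hρ hβ hS _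
      (hF.comp ((torusConfigShift v).measurable.comp (configPerm π).measurable))
      ⟨C, fun W => hC _⟩ hdep
  -- change of variables `U = Φ W`
  rw [← OddTorusRP.wilsonMeasure_map_configPerm_trans_torusConfigShift ρ hρ β π v,
    integral_map_equiv]
  refine h0.trans_eq (integral_congr_ae (Filter.Eventually.of_forall fun W => ?_))
  simp only [MeasurableEquiv.trans_apply, OddTorusRP.torusConfigShift_neg_torusConfigShift,
    OddTorusRP.configPerm_symm_configPerm]

end Summit.QuantumFields.YangMills.Theorems.FiniteSusceptibilityWeakCoupling

end
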